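import Mathlib.Tactic.Linarith
import Mathlib.Tactic.NormNum
import HarnessLib

/-!
# The (0,1) cell of the ι-window, XXXIX (companion C): the product ground `B₁ × B₂`, XXVI — THE CORNER XI, ADDENDUM 2
# (report [XXXIX] `H2-ZERO-ONE-39.md` §13): arithmetic shadow of THEOREM TWO-BLOCK-CAP

Family `hodge`, b2b cell `hweil` (helper of item stmt-HodgeConjecture-2524). Report
`run/shared/lean/b2b/hodge-weil/b2b-hweil-pv1-g51/H2-ZERO-ONE-39.md` ([XXXIX]) §13 (ADDENDUM 2). Context (the report's words, nothing of them formalised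
here): for a PLANAR ι-fixed S-line on which `x̃` has two Jordan blocks (layers of degrees `ε_j`, `ε₀ = ε₁ = 0`, superadditive) the invariant-socle feed
starts at the fourth layer: with `2χ⁺_i = 2 − ε_i + f_i` (`i` even) / `8 − ε_i − f_i` (`i` odd), `0 ≤ f_i ≤ min(6, ε_i)`, the partial sums from `i = 4` are
`≤ 2(1 − x_C)` when `ε₂, ε₃ ≤ 3`, whence `ε₅ ≥ 4` (`x_C = 1`) / `ε₅ ≥ 3` (`x_C = 0`); otherwise `ε₅ ≥ ε₂ + ε₃ ≥ 4`. With `ε_{m−1} ≥ ⌊(m−1)/5⌋ε₅` and the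
P-section bound `ε_{m−1} ≤ 38` for a line alone in its abelian surface: `m ≤ 50` / `m ≤ 65`, which excludes the planar two-block line off the height of `C`
in the five `h′ = 2` cells (`m ≥ 61` resp. `m = B ≥ 66`). The theorem below is the integer arithmetic. It claims no geometry. HONEST FRAMING: census work
inside the ladder's H2 test ((0,1) cell) on the SPECIAL fourfold `X₀`; nothing here is a rung; no case of the Hodge conjecture is proved; no statement of
[Markman 2025] / [Perry 2026] / [EdGFS 2025] is used.
-/

-- mandated namespace `Summit.HodgeConjecture.HodgeConjecture.…` (Problem = Summit) trips `linter.dupNamespace`; the lakefile disables it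
-- tree-wide (weak option), restated here so stand-alone elaboration is warning-free too.
set_option linter.dupNamespace false

namespace Summit.HodgeConjecture.HodgeConjecture.WeilTypeLadder

section ProductGroundTwentySixC

/-- **[XXXIX] 13.1–13.2 (THEOREM TWO-BLOCK-CAP).** (a) From `S₄ = 2 − ε₄ + f₄ ≤ 2s` and `S₅ = S₄ + 8 − ε₅ − f₅ ≤ 2s` (`s = 1 − x_C ∈ {0, 1}`) with
`0 ≤ f₄ ≤ ε₄`, `0 ≤ f₅ ≤ ε₅` and superadditivity `ε₄ ≤ ε₅`: `3ε₅ ≥ 10 − 2s`, so `ε₅ ≥ 4` (`s = 0`) and `ε₅ ≥ 3` (`s = 1`); if instead `ε₂ ≥ 4` or `ε₃ ≥ 4`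
then `ε₅ ≥ ε₂ + ε₃ ≥ 4`. (b) `4⌊(m − 1)/5⌋ ≤ 38 ⟹ m ≤ 50`; `3⌊(m − 1)/5⌋ ≤ 38 ⟹ m ≤ 65`; also `4⌊(m − 1)/2⌋ ≤ 38 ⟹ m ≤ 20`, `4⌊(m − 1)/3⌋ ≤ 38 ⟹ m ≤ 30`.
(c) The five `h′ = 2` cells: `B = 34 + 4d₃ ≥ 66` for `d₃ ≥ 8`; `B − 5 ≥ 61 > 50` and `B ≥ 66 > 65`. [`omega`] -/
theorem pg26c_two_block_cap :
    (∀ ε₄ ε₅ f₄ f₅ s : ℤ, 0 ≤ f₄ → f₄ ≤ ε₄ → 0 ≤ f₅ → f₅ ≤ ε₅ → ε₄ ≤ ε₅ → 0 ≤ s → s ≤ 1 →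
        2 - ε₄ + f₄ ≤ 2 * s → (2 - ε₄ + f₄) + (8 - ε₅ - f₅) ≤ 2 * s → 10 - 2 * s ≤ 3 * ε₅ ∧ (s = 0 → 4 ≤ ε₅) ∧ (s = 1 → 3 ≤ ε₅)) ∧
    (∀ ε₂ ε₃ ε₅ : ℤ, 0 ≤ ε₂ → 0 ≤ ε₃ → ε₂ + ε₃ ≤ ε₅ → (4 ≤ ε₂ ∨ 4 ≤ ε₃) → 4 ≤ ε₅) ∧
    (∀ m : ℤ, 1 ≤ m → 4 * ((m - 1) / 5) ≤ 38 → m ≤ 50) ∧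
    (∀ m : ℤ, 1 ≤ m → 3 * ((m - 1) / 5) ≤ 38 → m ≤ 65) ∧
    (∀ m : ℤ, 1 ≤ m → 4 * ((m - 1) / 2) ≤ 38 → m ≤ 20) ∧
    (∀ m : ℤ, 1 ≤ m → 4 * ((m - 1) / 3) ≤ 38 → m ≤ 30) ∧
    (∀ d₃ : ℤ, 8 ≤ d₃ → 66 ≤ 34 + 4 * d₃ ∧ 50 < 34 + 4 * d₃ - 5 ∧ 65 < 34 + 4 * d₃) := by
  refine ⟨fun ε₄ ε₅ f₄ f₅ s h1 h2 h3 h4 h5 h6 h7 h8 h9 => ⟨by omega, fun hs => by omega, fun hs => by omega⟩,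
    fun ε₂ ε₃ ε₅ h1 h2 h3 h4 => by omega, fun m hm h => by omega, fun m hm h => by omega, fun m hm h => by omega,
    fun m hm h => by omega, fun d₃ h => by omega⟩

end ProductGroundTwentySixC

end Summit.HodgeConjecture.HodgeConjecture.WeilTypeLadder
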